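import Literature.Computability.AlgebraicComplexity.ArithCircuitLabelled
import Literature.Computability.AlgebraicComplexity.CircuitGateSemantics
import HarnessLib

/-!
# Straight-line programs as labelled circuits, II: semantics, size, symmetry for free

Topic `Computability/AlgebraicComplexity`, namespace `Literature.Computability.AlgebraicComplexity`.
Continuation of `ArithCircuitLabelled.lean` (the labelled circuit
`ArithCircuit.Labelled.progCircuit P` of a straight-line program `P : ArithCircuit K σ` over the
trivially acted-on variables `TrivAct σ`; Dawar–Wilsenach 2025, Def. 2.2, for Bürgisser 2000,
Def. 2.1):

* SEMANTICS (`progCircuit_eval_node`, `progCircuit_eval_output`): the node of program gate `i`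
  computes `rename wrap (gateVal P i)` — by strong induction on `i` on top of the per-gate
  semantics `ArithCircuit.gateVal` / `ArithCircuit.opVal` of `CircuitGateSemantics.lean`: the
  gadget `term i t` computes `C cₜ * rename wrap (opVal P i uₜ)` (`progCircuit_eval_progSrc`:
  a forward or dangling reference reads the constant gate `0`, the junk value of `gateValues`),
  a sum node is `C 0 + Σₜ`, a product node `C 1 * ∏ₜ` of its gadgets — and the output computes
  `rename wrap P.eval`;
* SIZE (`card_progNode_eq`, `card_progNode_le`):
  `|σ| + |progConsts| + |P| + 2 Σᵢ arity i ≤ |σ| + 3 + |P| + 4 |P| A ≤ 6 (|P| + 1)(A + 1) + |σ|`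
  for gates of fan-in `≤ A`;
* SYMMETRY FOR FREE (`LabelledArithCircuit.isSymmetric_of_smul_eq_self`,
  `isSymmetric_trivAct_unit`, `isSymmetric_trivAct_trivAct`): if a group acts trivially on the
  variables and on the output indices, the identity permutation of the gates extends every group
  element (Defs. 3.6, 3.7), so every labelled circuit over `TrivAct σ` is symmetric for every
  group;
* the PACKAGED STATEMENT `ArithCircuit.exists_labelled`.

## References

* A. Dawar, G. Wilsenach, *Symmetric Arithmetic Circuits*, Theory of Computing 21 (2025),
  Defs. 2.2, 3.6, 3.7 and §3.3 (evaluation). [DawarWilsenach2025]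
* P. Bürgisser, *Completeness and Reduction in Algebraic Complexity Theory*, Springer 2000,
  Def. 2.1. [Burgisser2000]

Everything is folklore and proved; nothing here is a named fact.
-/

noncomputable section

open scoped Classical

namespace Literature.Computability.AlgebraicComplexity

open MvPolynomial SupportSymm

universe u v

/-! ### Symmetry for free under trivial actions -/

namespace LabelledArithCircuit

variable {K : Type*} {X : Type*} {Y : Type*} {G : Type*}

/-- If a group acts trivially on the variables and on the output indices, every labelled circuit
is symmetric: the identity permutation of the gates extends every group element
(Dawar–Wilsenach Defs. 3.6, 3.7). [cite: DawarWilsenach2025, Def. 3.7] -/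
theorem isSymmetric_of_smul_eq_self {Γ : Type*} [Group Γ] [MulAction Γ X] [MulAction Γ Y]
    (C : LabelledArithCircuit K X Y G) (hX : ∀ (γ : Γ) (x : X), γ • x = x)
    (hY : ∀ (γ : Γ) (y : Y), γ • y = y) : C.IsSymmetric Γ := fun γ =>
  ⟨1,
    { children_apply := fun g => by
        rw [Equiv.Perm.one_def, Equiv.refl_toEmbedding, Finset.map_refl]
        rfl
      label_apply := fun g => by
        rw [Equiv.Perm.one_apply]
        generalize C.label g = l
        cases l with
        | var x => rw [CircuitLabel.smul_var, hX]
        | const c => rfl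
        | add => rfl
        | mul => rfl
      output_smul := fun y => by rw [hY, Equiv.Perm.one_apply] }⟩

/-- Over the trivially acted-on variables `TrivAct α` and a single output, every labelled circuit
is symmetric for every group (whatever its action on `Unit`).
[cite: DawarWilsenach2025, Def. 3.7] -/
theorem isSymmetric_trivAct_unit {α : Type*} {Γ : Type*} [Group Γ] [MulAction Γ Unit]
    (C : LabelledArithCircuit K (TrivAct α) Unit G) : C.IsSymmetric Γ :=
  C.isSymmetric_of_smul_eq_self (fun γ x => TrivAct.smul_def γ x)
    fun _ _ => Subsingleton.elim _ _

/-- Over trivially acted-on variables `TrivAct α` and output indices `TrivAct β`, every labelled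
circuit is symmetric for every group. [cite: DawarWilsenach2025, Def. 3.7] -/
theorem isSymmetric_trivAct_trivAct {α : Type*} {β : Type*} {Γ : Type*} [Group Γ]
    (C : LabelledArithCircuit K (TrivAct α) (TrivAct β) G) : C.IsSymmetric Γ :=
  C.isSymmetric_of_smul_eq_self (fun γ x => TrivAct.smul_def γ x)
    fun γ y => TrivAct.smul_def γ y

end LabelledArithCircuit

namespace ArithCircuit

namespace Labelled

variable {K : Type u} {σ : Type v} [CommSemiring K] (P : ArithCircuit K σ)

/-! ### Per-gate semantics of the program -/

/-- `gateVal P i` is gate `i` evaluated against the values of the earlier gates.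
[cite: Burgisser2000, Def. 2.1] -/
theorem gateVal_eq_eval_gateAt (i : Fin P.size) :
    P.gateVal i = (gateAt P i).eval (gateValues (P.gates.take i)) := by
  unfold ArithCircuit.gateVal
  rw [List.getD_eq_getElem?_getD,
    gateValues_getElem? P.gates i _ (List.getElem?_eq_getElem i.2), Option.getD_some]
  rfl

/-- A sum gate: `gateVal P i = Σₜ cₜ • opVal P i uₜ`. [cite: Burgisser2000, Def. 2.1] -/
theorem gateVal_eq_sum_opVal (i : Fin P.size) (hs : (gateAt P i).isProd = false) :
    P.gateVal i = ∑ t : Fin (arity (gateAt P i)),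
      coeff (gateAt P i) t • P.opVal i (operand (gateAt P i) t) := by
  rw [gateVal_eq_eval_gateAt, gateEval_eq_sum _ _ hs]
  simp only [eval_gateValues_take]

/-- A product gate: `gateVal P i = ∏ₜ opVal P i uₜ`. [cite: Burgisser2000, Def. 2.1] -/
theorem gateVal_eq_prod_opVal (i : Fin P.size) (hs : (gateAt P i).isProd = true) :
    P.gateVal i = ∏ t : Fin (arity (gateAt P i)), P.opVal i (operand (gateAt P i) t) := by
  rw [gateVal_eq_eval_gateAt, gateEval_eq_prod _ _ hs]
  simp only [eval_gateValues_take]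

/-! ### Semantics of the labelled circuit -/

/-- Variable gates compute their (wrapped) variable. [cite: DawarWilsenach2025, §3.3] -/
theorem progCircuit_eval_inp (x : σ) :
    (progCircuit P).eval (.inp x) = X (TrivAct.wrap x) :=
  (progCircuit P).eval_of_label_var rfl

/-- Constant gates compute their constant. [cite: DawarWilsenach2025, §3.3] -/
theorem progCircuit_eval_cst (c : ↥(progConsts P)) :
    (progCircuit P).eval (.cst c) = C c.1 :=
  (progCircuit P).eval_of_label_const rfl

/-- The copy `opc i t` computes the source of operand `t`.
[cite: DawarWilsenach2025, §2 (evaluation)] -/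
theorem progCircuit_eval_opc (i : Fin P.size) (t : Fin (arity (gateAt P i))) :
    (progCircuit P).eval (.opc i t) =
      (progCircuit P).eval (progSrc P i (operand (gateAt P i) t)) := by
  rw [(progCircuit P).eval_of_label_add (show (progCircuit P).label (.opc i t) = .add from rfl)]
  exact Finset.sum_singleton _ _

/-- The gadget `term i t` computes `C cₜ * (source of operand t)`.
[cite: DawarWilsenach2025, §2 (evaluation)] -/
theorem progCircuit_eval_term (i : Fin P.size) (t : Fin (arity (gateAt P i))) :
    (progCircuit P).eval (.term i t) =
      C (coeff (gateAt P i) t) *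
        (progCircuit P).eval (progSrc P i (operand (gateAt P i) t)) := by
  rw [(progCircuit P).eval_of_label_mul (show (progCircuit P).label (.term i t) = .mul from rfl),
    ← progCircuit_eval_opc]
  change ∏ g ∈ ({ProgNode.cst ⟨coeff (gateAt P i) t, coeff_mem_progConsts P i t⟩,
    ProgNode.opc i t} : Finset (ProgNode P)), (progCircuit P).eval g = _
  rw [Finset.prod_pair (by simp), progCircuit_eval_cst]

/-- `term i` is injective in the operand position. [folklore] -/
theorem term_injective (i : Fin P.size) :
    Function.Injective
      (fun t : Fin (arity (gateAt P i)) => (ProgNode.term i t : ProgNode P)) := by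
  intro t t' h
  simpa using h

/-- The pad constant is not a gadget. [folklore] -/
theorem cst_notMem_image_term (i : Fin P.size) (c : ↥(progConsts P)) :
    (ProgNode.cst c : ProgNode P) ∉ Finset.univ.image fun t => ProgNode.term i t := by
  simp

/-- The node of a SUM gate computes `Σₜ term i t` (the pad constant `0` does not contribute).
[cite: DawarWilsenach2025, §2 (evaluation)] -/
theorem progCircuit_eval_node_of_sum (i : Fin P.size) (hs : (gateAt P i).isProd = false) :
    (progCircuit P).eval (.node i) =
      ∑ t : Fin (arity (gateAt P i)), (progCircuit P).eval (.term i t) := by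
  have hl : (progCircuit P).label (.node i) = .add := by
    change progGateLabel (gateAt P i) = .add
    revert hs
    cases gateAt P i with
    | sum _ => exact fun _ => rfl
    | prod _ => exact fun h => by simp [Gate.isProd] at h
  have hp : padConst (gateAt P i) = 0 := by
    revert hs
    cases gateAt P i with
    | sum _ => exact fun _ => rfl
    | prod _ => exact fun h => by simp [Gate.isProd] at h
  rw [(progCircuit P).eval_of_label_add hl]
  change ∑ g ∈ insert (ProgNode.cst ⟨padConst (gateAt P i), padConst_mem_progConsts P _⟩)
    (Finset.univ.image fun t => ProgNode.term i t), (progCircuit P).eval g = _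
  rw [Finset.sum_insert (cst_notMem_image_term P i _), progCircuit_eval_cst,
    Finset.sum_image fun t _ t' _ h => term_injective P i h]
  simp only [hp, C_0, zero_add]

/-- The node of a PRODUCT gate computes `∏ₜ term i t` (the pad constant `1` does not
contribute). [cite: DawarWilsenach2025, §2 (evaluation)] -/
theorem progCircuit_eval_node_of_prod (i : Fin P.size) (hs : (gateAt P i).isProd = true) :
    (progCircuit P).eval (.node i) =
      ∏ t : Fin (arity (gateAt P i)), (progCircuit P).eval (.term i t) := by
  have hl : (progCircuit P).label (.node i) = .mul := by
    change progGateLabel (gateAt P i) = .mul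
    revert hs
    cases gateAt P i with
    | sum _ => exact fun h => by simp [Gate.isProd] at h
    | prod _ => exact fun _ => rfl
  have hp : padConst (gateAt P i) = 1 := by
    revert hs
    cases gateAt P i with
    | sum _ => exact fun h => by simp [Gate.isProd] at h
    | prod _ => exact fun _ => rfl
  rw [(progCircuit P).eval_of_label_mul hl]
  change ∏ g ∈ insert (ProgNode.cst ⟨padConst (gateAt P i), padConst_mem_progConsts P _⟩)
    (Finset.univ.image fun t => ProgNode.term i t), (progCircuit P).eval g = _
  rw [Finset.prod_insert (cst_notMem_image_term P i _), progCircuit_eval_cst,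
    Finset.prod_image fun t _ t' _ h => term_injective P i h]
  simp only [hp, C_1, one_mul]

/-- **Sources.** Given the semantics of the nodes below level `i`, the source of an operand `u`
at level `i` computes `rename wrap (opVal P i u)` — including the junk cases (a reference
`gate j` with `j ≥ i` or `j ≥ |P|` reads `0`). [cite: Burgisser2000, Def. 2.1] -/
theorem progCircuit_eval_progSrc {i : ℕ}
    (ih : ∀ j : Fin P.size, (j : ℕ) < i →
      (progCircuit P).eval (.node j) = MvPolynomial.rename TrivAct.wrap (P.gateVal j))
    (u : Operand K σ) (hc : ∀ c, u = .const c → c ∈ progConsts P) :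
    (progCircuit P).eval (progSrc P i u) = MvPolynomial.rename TrivAct.wrap (P.opVal i u) := by
  cases u with
  | var x => rw [opVal_var, rename_X]; exact progCircuit_eval_inp P x
  | const c =>
    have h := hc c rfl
    simp only [progSrc, dif_pos h, progCircuit_eval_cst, opVal_const, rename_C]
  | gate j =>
    simp only [progSrc, opVal_gate]
    by_cases hji : j < i
    · by_cases hjs : j < P.size
      · rw [dif_pos ⟨hji, hjs⟩, if_pos hji]
        exact ih ⟨j, hjs⟩ hji
      · rw [dif_neg fun h => hjs h.2, if_pos hji, P.gateVal_of_le (not_lt.1 hjs), map_zero,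
          progCircuit_eval_cst, C_0]
    · rw [dif_neg fun h => hji h.1, if_neg hji, map_zero, progCircuit_eval_cst, C_0]

/-- **Semantics of the nodes.** The node of program gate `i` computes `rename wrap (gateVal P i)`
(strong induction on `i`). [cite: Burgisser2000, Def. 2.1] -/
theorem progCircuit_eval_node (i : Fin P.size) :
    (progCircuit P).eval (.node i) = MvPolynomial.rename TrivAct.wrap (P.gateVal i) := by
  suffices H : ∀ (m : ℕ) (i : Fin P.size), (i : ℕ) = m →
      (progCircuit P).eval (.node i) = MvPolynomial.rename TrivAct.wrap (P.gateVal i) from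
    H i i rfl
  intro m
  induction m using Nat.strong_induction_on with
  | _ m IH =>
    intro i hi
    have ih : ∀ j : Fin P.size, (j : ℕ) < i →
        (progCircuit P).eval (.node j) = MvPolynomial.rename TrivAct.wrap (P.gateVal j) :=
      fun j hj => IH j (hi ▸ hj) j rfl
    cases hs : (gateAt P i).isProd
    · rw [progCircuit_eval_node_of_sum P i hs, gateVal_eq_sum_opVal P i hs, map_sum]
      refine Finset.sum_congr rfl fun t _ => ?_
      rw [progCircuit_eval_term, progCircuit_eval_progSrc P ih _
        (fun c hc => mem_progConsts_of_operand_eq P i t hc), smul_eq_C_mul, map_mul, rename_C]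
    · rw [progCircuit_eval_node_of_prod P i hs, gateVal_eq_prod_opVal P i hs, map_prod]
      refine Finset.prod_congr rfl fun t _ => ?_
      rw [progCircuit_eval_term, progCircuit_eval_progSrc P ih _
        (fun c hc => mem_progConsts_of_operand_eq P i t hc), coeff_of_isProd _ hs, C_1, one_mul]

/-- **The labelled circuit computes the program's polynomial** (in the wrapped variables).
[cite: Burgisser2000, Def. 2.1] -/
theorem progCircuit_eval_output :
    (progCircuit P).eval ((progCircuit P).output ()) =
      MvPolynomial.rename TrivAct.wrap P.eval := by
  rw [progCircuit_output, eval_eq_opVal_output]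
  exact progCircuit_eval_progSrc P (fun j _ => progCircuit_eval_node P j) P.output
    fun c hc => mem_progConsts_of_output_eq P hc

/-! ### Size -/

/-- The exact gate count: `|σ| + |progConsts| + |P| + 2 Σᵢ arity i`. [folklore] -/
theorem card_progNode_eq [Fintype σ] : Fintype.card (ProgNode P) =
    Fintype.card σ + (progConsts P).card + P.size +
      ∑ i : Fin P.size, arity (gateAt P i) + ∑ i : Fin P.size, arity (gateAt P i) := by
  rw [Fintype.card_congr (ProgNode.equivSum P)]
  simp only [Fintype.card_sum, Fintype.card_sigma, Fintype.card_fin, Fintype.card_coe]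
  ring

/-- **Size.** With fan-in `≤ A` the labelled circuit of `P` has at most
`6 (|P| + 1)(A + 1) + |σ|` gates. [folklore] -/
theorem card_progNode_le [Fintype σ] (A : ℕ) (hA : ∀ g ∈ P.gates, g.fanIn ≤ A) :
    Fintype.card (ProgNode P) ≤ 6 * (P.size + 1) * (A + 1) + Fintype.card σ := by
  have h1 : ∑ i : Fin P.size, arity (gateAt P i) ≤ P.size * A := by
    have := Finset.sum_le_card_nsmul (Finset.univ : Finset (Fin P.size))
      (fun i => arity (gateAt P i)) A (fun i _ => arity_gateAt_le P hA i)
    simpa using this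
  have h2 : ∑ i : Fin P.size, 2 * arity (gateAt P i) ≤ 2 * (P.size * A) := by
    rw [← Finset.mul_sum]
    exact Nat.mul_le_mul_left 2 h1
  have hc := card_progConsts_le P
  have key : 6 * (P.size + 1) * (A + 1) = 6 * (P.size * A) + 6 * P.size + 6 * A + 6 := by ring
  rw [card_progNode_eq, key]
  generalize P.size * A = m at h1 h2 ⊢
  generalize ∑ i : Fin P.size, arity (gateAt P i) = S at h1 ⊢
  generalize ∑ i : Fin P.size, 2 * arity (gateAt P i) = S' at h2 hc
  omega

end Labelled

/-- **Straight-line programs are labelled circuits.** Every arithmetic circuit `P` (Bürgisser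
Def. 2.1: weighted-sum and product gates over `var`/`const`/`gate j` operands, junk value `0`
for forward or dangling references) whose gates have fan-in `≤ A` is computed — as
`rename TrivAct.wrap P.eval`, over the same variables carried by `TrivAct σ` — by a
Dawar–Wilsenach labelled circuit (Def. 2.2) on at most `6 (|P| + 1)(A + 1) + |σ|` gates
(`Labelled.progCircuit`: one input gate per variable, one constant gate per constant used, and
per gate a `+`/`×` node over gadgets `weight × copy of operand`). Over `TrivAct σ` such a
circuit is symmetric for every group (`LabelledArithCircuit.isSymmetric_trivAct_unit`).
[cite: DawarWilsenach2025, Def. 2.2] -/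
theorem exists_labelled {K : Type u} [CommSemiring K] {σ : Type v} [Fintype σ]
    (P : ArithCircuit K σ) (A : ℕ) (hA : ∀ g ∈ P.gates, g.fanIn ≤ A) :
    ∃ (G : Type (max u v)) (_ : Fintype G) (C : LabelledArithCircuit K (TrivAct σ) Unit G),
      C.eval (C.output ()) = MvPolynomial.rename TrivAct.wrap P.eval ∧
        Fintype.card G ≤ 6 * (P.size + 1) * (A + 1) + Fintype.card σ :=
  ⟨Labelled.ProgNode P, inferInstance, Labelled.progCircuit P,
    Labelled.progCircuit_eval_output P, Labelled.card_progNode_le P A hA⟩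

end ArithCircuit

end Literature.Computability.AlgebraicComplexity

end
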